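import Literature.AlgebraicGeometry.Motives.MixedHodgeExtensionHomFunctorClass
import HarnessLib

/-!
# Transposition `Hom(X, Y) ≅ Hom(Y^∨, X^∨)` and the extensions `Hom(E, C) ≅ Hom(C^∨, E^∨)`

Deligne, *Théorie de Hodge II*, 1.1.12: `Hom` and `⊗` of (bi)filtered objects are functorial and
compatible with duality; Cattani–El Zein–Griffiths–Lê §3.2.2.7: `Hom(H₁, H₂) ≅ H₁^∨ ⊗ H₂` as mixed Hodge
structures; Fujiki, *Duality of mixed Hodge structures* (1980), (1.6.2) a): the biduality `H ≅ H^∨∨` is an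
isomorphism of MHS (the tree's `Hom.bidual`). Carlson, *Extensions of mixed Hodge structures* (1980),
§2(c) Remark (3): the dual extension `E^∨` (the tree's `Extension.dual`, `Ext.dualEquivW`). Mac Lane,
*Homology* III Prop. 1.8: `β_* E ≡ α^* E'` along a morphism of extensions `(β, φ, α)`.

This file proves (finite-dimensional carriers):

* §1 **the transposition `homTranspose X Y : Hom(X, Y) → Hom(Y^∨, X^∨)` is a morphism of mixed Hodge
  structures** — the composite `Hom(X, Y) ≅ X^∨ ⊗ Y ≅ Y ⊗ X^∨ —(bidual ⊗ 1)→ Y^∨∨ ⊗ X^∨ ≅ Hom(Y^∨, X^∨)` of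
  isomorphisms of MHS in the tree — with underlying map **`f ↦ ᵗf`** (`homTranspose_toLinearMap_apply`),
  bijective;
* §2 **the isomorphism of extensions `Hom(E, C) → Hom(C^∨, E^∨)`** over `Hom(A, C) ≅ Hom(C^∨, A^∨)`,
  `Hom(B, C) ≅ Hom(C^∨, B^∨)` (`Extension.homRightToDualHomLeft`; squares `ᵗ(f ∘ π) = ᵗπ ∘ ᵗf`), the
  congruence `(≅)_* Hom(E, C) ≡ (≅)^* Hom(C^∨, E^∨)`, and `Hom(E, C)` splits iff `Hom(C^∨, E^∨)` splits;
* §3 on `Ext`: **`(≅)_* Hom(x, C) = (≅)^* Hom(C^∨, x^∨)`** (`x^∨ = Ext.dualEquivW x`), the solved forms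
  `Hom(x, C) = (≅⁻¹)_* (≅)^* Hom(C^∨, x^∨)`, `Hom(C^∨, x^∨) = (≅⁻¹)^* (≅)_* Hom(x, C)`, and on classes
  `(≅)_* JHomW.homRight C c = (≅)^* JHomW.homLeft C^∨ (−ᵗc)`.

All statements proved; no named facts.

## References

* [DeligneHodgeII1971] P. Deligne, Théorie de Hodge II, 1.1.12.
* [CattaniElZeinGriffithsLe2014] E. Cattani et al. (eds.), Hodge Theory (2014), §3.2.2.7.
* [Fujiki1980] A. Fujiki, Duality of mixed Hodge structures of algebraic varieties (1980), (1.6.2) a).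
* [Carlson1980] J. A. Carlson, Extensions of mixed Hodge structures (1980), §2(c) Remark (3).
* [MacLane1963Homology] S. Mac Lane, Homology (1963), Ch. III §1 Prop. 1.8.
* [BrylinskiZucker1998] J.-L. Brylinski, S. Zucker, An overview of recent advances in Hodge theory,
  Prop. 5.22.
-/

noncomputable section

open scoped TensorProduct

namespace Literature.AlgebraicGeometry.Motives

namespace MixedHodgeStructure

/-! ### §1 The transposition `Hom(X, Y) → Hom(Y^∨, X^∨)` as a morphism of mixed Hodge structures -/

section Transpose

variable {VX : Type*} [AddCommGroup VX] [Module ℚ VX] [FiniteDimensional ℚ VX]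
variable {VY : Type*} [AddCommGroup VY] [Module ℚ VY] [FiniteDimensional ℚ VY]
variable (X : MixedHodgeStructure VX) (Y : MixedHodgeStructure VY)

/-- **The transposition `Hom(X, Y) → Hom(Y^∨, X^∨)`, `f ↦ ᵗf`, is a morphism of mixed Hodge structures**:
the composite `Hom(X, Y) ≅ X^∨ ⊗ Y ≅ Y ⊗ X^∨ —(i_Y ⊗ 1)→ Y^∨∨ ⊗ X^∨ ≅ Hom(Y^∨, X^∨)` (`homToTensor`, symmetry,
biduality `Hom.bidual`, `tensorToHom`). [cite: DeligneHodgeII1971, 1.1.12] [cite: CattaniElZeinGriffithsLe2014, §3.2.2.7]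
[cite: Fujiki1980, (1.6.2) a)] -/
def homTranspose : Hom (hom X Y) (hom Y.dual X.dual) :=
  (tensorToHom Y.dual X.dual).comp
    (((Hom.bidual Y).tensorMap (Hom.id X.dual)).comp ((tensorComm X.dual Y).comp (homToTensor X Y)))

omit [FiniteDimensional ℚ VY] in
/-- `dualTensorHomEquiv = dualTensorHom` pointwise. [folklore] -/
private theorem dualTensorHomEquiv_apply_eq (t : Module.Dual ℚ VX ⊗[ℚ] VY) :
    dualTensorHomEquiv ℚ VX VY t = dualTensorHom ℚ VX VY t := by
  rw [dualTensorHomEquiv, dualTensorHomEquivOfBasis_apply]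

/-- On `ξ ⊗ y ∈ X^∨ ⊗ Y`: `tensorToHom ((i_Y y) ⊗ ξ) = (η ↦ η(y) ξ) = ᵗ(x ↦ ξ(x) y)`. [folklore] -/
private theorem homTranspose_aux (t : Module.Dual ℚ VX ⊗[ℚ] VY) :
    (tensorToHom Y.dual X.dual).toLinearMap
        (((Hom.bidual Y).tensorMap (Hom.id X.dual)).toLinearMap
          (TensorProduct.comm ℚ (Module.Dual ℚ VX) VY t)) =
      Module.Dual.transpose (R := ℚ) (dualTensorHom ℚ VX VY t) := by
  induction t using TensorProduct.induction_on with
  | zero => simp only [map_zero]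
  | add x y hx hy => simp only [map_add, hx, hy]
  | tmul ξ y =>
    rw [TensorProduct.comm_tmul, Hom.tensorMap_apply_tmul, Hom.bidual_toLinearMap, Hom.id_toLinearMap,
      LinearMap.id_apply]
    refine LinearMap.ext fun η => LinearMap.ext fun x => ?_
    rw [tensorToHom_apply_tmul, Module.Dual.eval_apply, LinearMap.smul_apply, Module.Dual.transpose_apply,
      LinearMap.comp_apply, dualTensorHom_apply, map_smul, smul_eq_mul, smul_eq_mul, mul_comm]

/-- **The underlying map of `homTranspose` is `f ↦ ᵗf`** (`LinearMap.dualMap`). [cite: DeligneHodgeII1971, 1.1.12] -/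
@[simp]
theorem homTranspose_toLinearMap_apply (f : VX →ₗ[ℚ] VY) : (homTranspose X Y).toLinearMap f = f.dualMap := by
  rw [homTranspose, Hom.comp_toLinearMap, Hom.comp_toLinearMap, Hom.comp_toLinearMap, LinearMap.comp_apply,
    LinearMap.comp_apply, LinearMap.comp_apply, homToTensor_toLinearMap, tensorComm_toLinearMap,
    LinearEquiv.coe_coe, LinearEquiv.coe_coe, homTranspose_aux]
  have hf : dualTensorHom ℚ VX VY ((dualTensorHomEquiv ℚ VX VY).symm f) = f := by
    rw [← dualTensorHomEquiv_apply_eq, LinearEquiv.apply_symm_apply]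
  rw [hf]
  rfl

/-- `Hom(1, 1)`-compatibility: the transposition of MHS-morphism classes is the tree's `Hom.transpose` on
underlying maps: `homTranspose (g) = ᵗg = (Hom.transpose g)` for `g : X → Y`. [cite: CattaniElZeinGriffithsLe2014, §3.2.2.7] -/
theorem homTranspose_toLinearMap_apply_hom (g : Hom X Y) :
    (homTranspose X Y).toLinearMap g.toLinearMap = g.transpose.toLinearMap := by
  rw [homTranspose_toLinearMap_apply, Hom.transpose_toLinearMap]

/-- **`homTranspose` is bijective** (a composite of isomorphisms of MHS; `i_Y ⊗ 1` is bijective by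
reflexivity of finite-dimensional spaces). [cite: Fujiki1980, (1.6.2) a)] [cite: CattaniElZeinGriffithsLe2014, Thm. 3.2.18] -/
theorem homTranspose_bijective : Function.Bijective (homTranspose X Y).toLinearMap := by
  have hb : Function.Bijective ((Hom.bidual Y).tensorMap (Hom.id X.dual)).toLinearMap := by
    rw [Hom.tensorMap_toLinearMap, Hom.bidual_toLinearMap, Hom.id_toLinearMap]
    exact (TensorProduct.congr (Module.evalEquiv ℚ VY) (LinearEquiv.refl ℚ (Module.Dual ℚ VX))).bijective
  rw [homTranspose, Hom.comp_toLinearMap, Hom.comp_toLinearMap, Hom.comp_toLinearMap, LinearMap.coe_comp,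
    LinearMap.coe_comp, LinearMap.coe_comp]
  exact (tensorToHom_bijective Y.dual X.dual).comp
    (hb.comp ((tensorComm_bijective X.dual Y).comp (homToTensor_bijective X Y)))

/-- The inverse isomorphism `Hom(Y^∨, X^∨) → Hom(X, Y)` (the tree's `Hom.inverse`). [cite: CattaniElZeinGriffithsLe2014, Thm. 3.2.18] -/
def homTransposeInv : Hom (hom Y.dual X.dual) (hom X Y) :=
  (homTranspose X Y).inverse (homTranspose_bijective X Y)

/-- `homTransposeInv ∘ homTranspose = id`. [cite: CattaniElZeinGriffithsLe2014, Thm. 3.2.18] -/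
theorem homTransposeInv_comp_homTranspose : (homTransposeInv X Y).comp (homTranspose X Y) = Hom.id (hom X Y) :=
  Hom.inverse_comp _ _

/-- `homTranspose ∘ homTransposeInv = id`. [cite: CattaniElZeinGriffithsLe2014, Thm. 3.2.18] -/
theorem homTranspose_comp_homTransposeInv :
    (homTranspose X Y).comp (homTransposeInv X Y) = Hom.id (hom Y.dual X.dual) :=
  Hom.comp_inverse _ _

/-- `homTransposeInv (ᵗf) = f`. [cite: CattaniElZeinGriffithsLe2014, Thm. 3.2.18] -/
@[simp]
theorem homTransposeInv_toLinearMap_dualMap (f : VX →ₗ[ℚ] VY) :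
    (homTransposeInv X Y).toLinearMap f.dualMap = f := by
  have h := congrArg (fun φ : Hom (hom X Y) (hom X Y) => φ.toLinearMap f) (homTransposeInv_comp_homTranspose X Y)
  simpa only [Hom.comp_toLinearMap, LinearMap.comp_apply, homTranspose_toLinearMap_apply, Hom.id_toLinearMap,
    LinearMap.id_apply] using h

end Transpose

/-! ### §2 The isomorphism of extensions `Hom(E, C) → Hom(C^∨, E^∨)` -/

section Extensions

variable {VA : Type*} [AddCommGroup VA] [Module ℚ VA] [FiniteDimensional ℚ VA]
variable {VB : Type*} [AddCommGroup VB] [Module ℚ VB] [FiniteDimensional ℚ VB]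
variable {VC : Type*} [AddCommGroup VC] [Module ℚ VC] [FiniteDimensional ℚ VC]
variable {VE : Type*} [AddCommGroup VE] [Module ℚ VE] [FiniteDimensional ℚ VE]
variable {A : MixedHodgeStructure VA} {B : MixedHodgeStructure VB}

namespace Extension

variable (E : Extension A B VE) (C : MixedHodgeStructure VC)

/-- **The isomorphism of extensions `Hom(E, C) → Hom(C^∨, E^∨)`** (`E^∨ : 0 → A^∨ → E^∨ → B^∨ → 0` the dual
extension; components the transpositions `Hom(A, C) → Hom(C^∨, A^∨)`, `Hom(E, C) → Hom(C^∨, E^∨)`,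
`Hom(B, C) → Hom(C^∨, B^∨)`; squares `ᵗ(f ∘ π) = ᵗπ ∘ ᵗf`, `ᵗ(g ∘ i) = ᵗi ∘ ᵗg`).
[cite: DeligneHodgeII1971, 1.1.12] [cite: Carlson1980, §2(c) Remark (3)] -/
def homRightToDualHomLeft : Morphism (E.homRight C) (E.dual.homLeft C.dual) where
  left := homTranspose A C
  mid := homTranspose E.mhs C
  right := homTranspose B C
  mid_inc := by
    change (homTranspose E.mhs C).toLinearMap ∘ₗ (Hom.homMap E.proj (Hom.id C)).toLinearMap =
      (Hom.homMap (Hom.id C.dual) E.proj.transpose).toLinearMap ∘ₗ (homTranspose A C).toLinearMap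
    refine LinearMap.ext fun f => ?_
    simp only [LinearMap.comp_apply, homTranspose_toLinearMap_apply, Hom.homMap_toLinearMap_apply,
      Hom.id_toLinearMap, LinearMap.id_comp, LinearMap.comp_id, Hom.transpose_toLinearMap,
      LinearMap.dualMap_comp_dualMap]
  proj_mid := by
    change (Hom.homMap (Hom.id C.dual) E.inc.transpose).toLinearMap ∘ₗ (homTranspose E.mhs C).toLinearMap =
      (homTranspose B C).toLinearMap ∘ₗ (Hom.homMap E.inc (Hom.id C)).toLinearMap
    refine LinearMap.ext fun f => ?_
    simp only [LinearMap.comp_apply, homTranspose_toLinearMap_apply, Hom.homMap_toLinearMap_apply,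
      Hom.id_toLinearMap, LinearMap.id_comp, LinearMap.comp_id, Hom.transpose_toLinearMap,
      LinearMap.dualMap_comp_dualMap]

/-- Components of `Hom(E, C) → Hom(C^∨, E^∨)` (by `rfl`). [cite: DeligneHodgeII1971, 1.1.12] -/
@[simp]
theorem homRightToDualHomLeft_left : (E.homRightToDualHomLeft C).left = homTranspose A C := rfl

/-- Components of `Hom(E, C) → Hom(C^∨, E^∨)` (by `rfl`). [cite: DeligneHodgeII1971, 1.1.12] -/
@[simp]
theorem homRightToDualHomLeft_mid : (E.homRightToDualHomLeft C).mid = homTranspose E.mhs C := rfl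

/-- Components of `Hom(E, C) → Hom(C^∨, E^∨)` (by `rfl`). [cite: DeligneHodgeII1971, 1.1.12] -/
@[simp]
theorem homRightToDualHomLeft_right : (E.homRightToDualHomLeft C).right = homTranspose B C := rfl

/-- **`(Hom(A, C) ≅ Hom(C^∨, A^∨))_* Hom(E, C) ≡ (Hom(B, C) ≅ Hom(C^∨, B^∨))^* Hom(C^∨, E^∨)`.**
[cite: MacLane1963Homology, Ch. III Prop. 1.8] [cite: Carlson1980, §2(c) Remark (3)] -/
theorem nonempty_congruence_homRight_pushout_dual_homLeft_pullback :
    Nonempty (Congruence ((E.homRight C).pushout (homTranspose A C))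
      ((E.dual.homLeft C.dual).pullback (homTranspose B C))) :=
  nonempty_congruence_pushout_pullback_of_morphism (E.homRightToDualHomLeft C)

/-- In the complete invariant: `(≅)_* [Hom(E, C)]_W = (≅)^* [Hom(C^∨, E^∨)]_W`. [cite: MacLane1963Homology, Ch. III Prop. 1.8] -/
theorem postcomp_clsW_homRight_eq_precomp_clsW_dual_homLeft :
    JHomW.postcomp (hom B C) (homTranspose A C) (E.homRight C).clsW =
      JHomW.precomp (hom C.dual A.dual) (homTranspose B C) (E.dual.homLeft C.dual).clsW :=
  (E.homRightToDualHomLeft C).postcomp_clsW_eq_precomp_clsW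

/-- **The class of `Hom(C^∨, E^∨)` from that of `Hom(E, C)`**:
`[Hom(C^∨, E^∨)]_W = ((≅_B)⁻¹)^* (≅_A)_* [Hom(E, C)]_W`. [cite: MacLane1963Homology, Ch. III Prop. 1.8] -/
theorem clsW_dual_homLeft_eq :
    (E.dual.homLeft C.dual).clsW =
      JHomW.precomp (hom C.dual A.dual) (homTransposeInv B C)
        (JHomW.postcomp (hom B C) (homTranspose A C) (E.homRight C).clsW) := by
  rw [postcomp_clsW_homRight_eq_precomp_clsW_dual_homLeft,
    JHomW.precomp_precomp_of_comp_eq_id _ _ (homTranspose_comp_homTransposeInv B C)]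

/-- **`Hom(E, C)` splits iff `Hom(C^∨, E^∨)` splits.** [cite: MacLane1963Homology, Ch. III Prop. 1.8] -/
theorem isSplit_homRight_iff_isSplit_dual_homLeft :
    (E.homRight C).IsSplit ↔ (E.dual.homLeft C.dual).IsSplit := by
  rw [isSplit_iff_clsW_eq_zero, isSplit_iff_clsW_eq_zero]
  constructor
  · intro h
    rw [clsW_dual_homLeft_eq, h, map_zero, map_zero]
  · intro h
    have h1 := E.postcomp_clsW_homRight_eq_precomp_clsW_dual_homLeft C
    rw [h, map_zero] at h1
    have h2 := congrArg (JHomW.postcomp (hom B C) (homTransposeInv A C)) h1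
    rwa [JHomW.postcomp_postcomp_of_comp_eq_id _ _ (homTransposeInv_comp_homTranspose A C), map_zero] at h2

end Extension

/-! ### §3 On `Ext` and on classes -/

namespace Ext

variable (C : MixedHodgeStructure VC)

/-- **`(Hom(A, C) ≅ Hom(C^∨, A^∨))_* Hom(x, C) = (Hom(B, C) ≅ Hom(C^∨, B^∨))^* Hom(C^∨, x^∨)`** on `Ext`
(`x^∨ = Ext.dualEquivW x`): `Hom(−, C)` on extensions is `Hom(C^∨, −)` of the dual extension, up to
transposition. [cite: Carlson1980, §2(c) Remark (3)] [cite: MacLane1963Homology, Ch. III Prop. 1.8] -/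
theorem pushoutMapW_homTranspose_homRightMap (x : Ext A B) :
    pushoutMapW (homTranspose A C) (homRightMap C x) =
      pullbackMapW (homTranspose B C) (homLeftMap C.dual (dualEquivW x)) := by
  obtain ⟨E, rfl⟩ := exists_mkOfW_eq x
  rw [homRightMap_mkOfW, dualEquivW_mkOfW, homLeftMap_mkOfW]
  exact pushoutMapW_mkOfW_eq_pullbackMapW_mkOfW (E.homRightToDualHomLeft C)

/-- **`Hom(x, C) = (≅_A⁻¹)_* (≅_B)^* Hom(C^∨, x^∨)`.** [cite: Carlson1980, §2(c) Remark (3)] -/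
theorem homRightMap_eq_pushoutMapW_pullbackMapW_homLeftMap_dual (x : Ext A B) :
    homRightMap C x =
      pushoutMapW (homTransposeInv A C)
        (pullbackMapW (homTranspose B C) (homLeftMap C.dual (dualEquivW x))) := by
  rw [← pushoutMapW_homTranspose_homRightMap,
    pushoutMapW_pushoutMapW_of_comp_eq_id _ _ (homTransposeInv_comp_homTranspose A C)]

/-- **`Hom(C^∨, x^∨) = (≅_B⁻¹)^* (≅_A)_* Hom(x, C)`.** [cite: Carlson1980, §2(c) Remark (3)] -/
theorem homLeftMap_dual_dualEquivW_eq (x : Ext A B) :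
    homLeftMap C.dual (dualEquivW x) =
      pullbackMapW (homTransposeInv B C) (pushoutMapW (homTranspose A C) (homRightMap C x)) := by
  rw [pushoutMapW_homTranspose_homRightMap,
    pullbackMapW_pullbackMapW_of_comp_eq_id _ _ (homTranspose_comp_homTransposeInv B C)]

/-- `Hom(x, C)` splits iff `Hom(C^∨, x^∨)` splits. [cite: MacLane1963Homology, Ch. III Prop. 1.8] -/
theorem homRightMap_eq_zeroW_iff_homLeftMap_dual (x : Ext A B) :
    homRightMap C x = zeroW ↔ homLeftMap C.dual (dualEquivW x) = zeroW := by
  obtain ⟨E, rfl⟩ := exists_mkOfW_eq x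
  rw [homRightMap_mkOfW, dualEquivW_mkOfW, homLeftMap_mkOfW, mkOfW_eq_zeroW_iff, mkOfW_eq_zeroW_iff,
    Extension.isSplit_homRight_iff_isSplit_dual_homLeft]

end Ext

variable (C : MixedHodgeStructure VC)

set_option maxHeartbeats 400000 in
/-- **On classes: `(≅_A)_* Hom(c, C) = (≅_B)^* Hom(C^∨, −ᵗc)`** in `J⁰W₀Hom(Hom(B, C), Hom(C^∨, A^∨))` — the
class maps `JHomW.homRight C` and `JHomW.homLeft C^∨ ∘ (−transposeW)` agree up to transposition
(every class is the class of an extension). [cite: BrylinskiZucker1998, Prop. 5.22] [cite: Carlson1980, §2(c) Remark (3)] -/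
theorem JHomW.postcomp_homTranspose_homRight (c : JHomW A B) :
    JHomW.postcomp (hom B C) (homTranspose A C) (JHomW.homRight C c) =
      JHomW.precomp (hom C.dual A.dual) (homTranspose B C)
        (JHomW.homLeft C.dual (-JHomW.transposeW A B c)) := by
  obtain ⟨x, rfl⟩ := Ext.extEquivJHomW.surjective c
  rw [Ext.extEquivJHomW_apply x, ← Ext.clsW_homRightMap, ← Ext.extEquivJHomW_pushoutMapW,
    Ext.pushoutMapW_homTranspose_homRightMap, Ext.extEquivJHomW_pullbackMapW, Ext.clsW_homLeftMap,
    Ext.clsW_dualEquivW]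

end Extensions

end MixedHodgeStructure

end Literature.AlgebraicGeometry.Motives

end
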